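import Summits.Parity.GeneralizedHardyLittlewood.Theorems.PrimeLevelFamEdgeMomentsBeyondDiagonalFarLayersPairSum
import HarnessLib

/-!
# Route `PrimeLevelFamEdge`, crux K_A `MomentsBeyondDiagonal` (stmt-Parity-20007), line «petersson_layers» v4:
# the FAR PETERSSON LAYERS at orders `(i, j)` — the box sum of the layers `R < r ≤ q⁸` beyond the Weil cut

For `q` prime `≥ 64`, `0 < Δ' ≤ 3/2` (`M = q̂^{Δ'}`) and a layer threshold `R` with `R + 1 ≥ q̂^{4Δ' − 3/2}` (the WEIL CUT
`ρ_W` of deck 21b §5b), the order-`(i,j)` box sum of the far layers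
`Σ_{n₁,n₂ ≤ q²} (n₁n₂)^{−1/2} W_{ij}(q̂;n₁,n₂) Σ_{m₁,m₂ ≤ M} x_{m₁}x_{m₂} Σ_{d₁,d₂} Σ_{R < r ≤ q⁸} (2π/q) r⁻¹ S(a,b;qr) J₁(4π√(ab)/(qr))`
is `≤ A_{P,i,j} · ((1+log q̂)(1+2 log q))^{i+j} · q̂^{−3/40}` (`norm_farBox₂_le`). THE COUNT (deck 21b §5b) made quantitative
with every `ε` at `1/100`: exponent `−3 + 203Δ'/100 + 51/25 − (12/25)(4Δ' − 3/2) = −6/25 + 11Δ'/100 ≤ −3/40`. Ingredients: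
the gcd-honest kernel sum `FarLayers.sum_norm_layerKernel_le` (Weil + `|J₁(x)| ≤ x/2` + gcd sum), `|x_m| ≤ B m^{−1/2}`,
`τ ≤ C(·)^{1/100}`, the weight decay `norm_afeW_le_logsep` at `A = 51/50` (`weight₂_mul_sqrt_le`, file `…FarLayersPairSum`), and the level split
`Σ_{n ≤ q²} n^{−51/50} τ(n) √(n,q) ≤ 2Cζ` (`sum_box_rpow_divisors_gcd_le`: the multiples of `q` carry `√q · q^{−101/100} ≤ 1`).
Proof only (helper toward `stub_farP : SubFar rhoP`); K_A NOT proved; nothing about Landau–Siegel zeros.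
-/

noncomputable section

open scoped Real Nat
open Complex Finset Polynomial MeasureTheory
open Literature.NumberTheory.LFunctions

namespace Summit.Parity.GeneralizedHardyLittlewood.Theorems.MomentsBeyondDiagonal.FarLayers

open Summit.Parity.GeneralizedHardyLittlewood.Theorems.PrimeLevelFamEdgeIdeaDeltas.PeterssonLayers


/-! ## §4. The far-layer box sum at orders `(i, j)` -/

/-- **THE FAR PETERSSON LAYERS AT ORDERS `(i,j)`, BEYOND THE WEIL CUT.** For `q` prime `≥ 64`, `0 < Δ' ≤ 3/2`
(`M = q̂^{Δ'}`) and `R + 1 ≥ q̂^{4Δ' − 3/2}`: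
`‖Σ_{n₁,n₂ ≤ q²} (n₁n₂)^{−1/2} W_{ij}(q̂;n₁,n₂) Σ_{m₁,m₂ ≤ M} x x Σ_{d₁,d₂} Σ_{R < r ≤ q⁸} K_r-kernel(a,b)‖
≤ A_P ((1+log q̂)(1+2 log q))^{i+j} q̂^{−3/40}` (THE COUNT of deck 21b §5b: Weil + `|J₁(x)| ≤ x/2`, block total
`q̂^{2Δ'+ε} r^{−1/2}`, made exact with the gcd: exponent `−6/25 + 11Δ'/100 ≤ −3/40`).
[cite: KowalskiMichelVanderKam2000, (21)–(22) p. 12; KowalskiMichel2000, §2.4.2 p. 312 (23); Iwaniec2002, §2.5 (2.25)] -/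
theorem norm_farBox₂_le (P : ℝ[X]) (i j : ℕ) :
    ∃ A : ℝ, 0 ≤ A ∧ ∀ (q : ℕ) [NeZero q], q.Prime → 64 ≤ q → ∀ Δ' : ℝ, 0 < Δ' → Δ' ≤ 3 / 2 → ∀ R : ℕ,
      KMV2000.qhat q ^ (4 * Δ' - 3 / 2) ≤ ((R + 1 : ℕ) : ℝ) →
      ‖∑ n₁ ∈ afeBox q, ∑ n₂ ∈ afeBox q,
          ((((n₁ : ℝ) * n₂) ^ (-(1 / 2 : ℝ)) : ℝ) : ℂ) * KMV2000.afeW (KMV2000.qhat q) i j n₁ n₂ *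
          ∑ m₁ ∈ Icc 1 ⌊KMV2000.qhat q ^ Δ'⌋₊, ∑ m₂ ∈ Icc 1 ⌊KMV2000.qhat q ^ Δ'⌋₊,
            (KMV2000.mollifierCoeff P (KMV2000.qhat q ^ Δ') m₁ : ℂ) *
              (KMV2000.mollifierCoeff P (KMV2000.qhat q ^ Δ') m₂ : ℂ) *
            ∑ d₁ ∈ (Nat.gcd m₁ n₁).divisors, ∑ d₂ ∈ (Nat.gcd m₂ n₂).divisors,
              ∑ r ∈ Icc (R + 1) (q ^ 8), layerKernel q r (m₁ * n₁ / d₁ ^ 2) (m₂ * n₂ / d₂ ^ 2)‖ ≤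
        A * ((1 + Real.log (KMV2000.qhat q)) * (1 + 2 * Real.log q)) ^ (i + j) *
          KMV2000.qhat q ^ (-(3 / 40 : ℝ)) := by
  obtain ⟨Kw, hKw0, hKw⟩ := weight₂_mul_sqrt_le i j
  obtain ⟨C, hC1, hC⟩ :=
    Literature.NumberTheory.Sieve.exists_card_divisors_le_mul_rpow' (by norm_num : (0 : ℝ) < 1 / 100)
  have hC0 : 0 ≤ C := zero_le_one.trans hC1
  set B : ℝ := ∑ i ∈ range (P.natDegree + 1), |P.coeff i| with hBdef
  have hB : ∀ t ∈ Set.Icc (0 : ℝ) 1, |P.eval t| ≤ B := fun t ht ↦ abs_eval_le_sum_abs_coeff P ht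
  have hB0 : 0 ≤ B := le_trans (abs_nonneg _) (hB 0 (by simp))
  set Z₁ : ℝ := ∑' k : ℕ, ((k : ℝ)) ^ (-(101 / 100 : ℝ)) with hZ₁
  have hZ₁0 : 0 ≤ Z₁ := tsum_nonneg fun k ↦ Real.rpow_nonneg (Nat.cast_nonneg _) _
  have hZ₂s : Summable (fun n : ℕ ↦ ((n : ℝ)) ^ (-(51 / 50 : ℝ))) := Real.summable_nat_rpow.mpr (by norm_num)
  set Z₂ : ℝ := ∑' n : ℕ, ((n : ℝ)) ^ (-(51 / 50 : ℝ)) with hZ₂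
  have hZ₂0 : 0 ≤ Z₂ := tsum_nonneg fun n ↦ Real.rpow_nonneg (Nat.cast_nonneg _) _
  refine ⟨8 * π ^ 2 * C * Z₁ * (B ^ 2 * C ^ 3) * Kw * (2 * C * Z₁) * Z₂, by positivity,
    fun q _ hq h64 Δ' h0 h32 R hR ↦ ?_⟩
  set L : ℝ := ((1 + Real.log (KMV2000.qhat q)) * (1 + 2 * Real.log q)) ^ (i + j) with hLdef
  obtain ⟨hM1, hM32, hMq⟩ := mollifierLength_facts h64 h0 h32
  have hqh1 : 1 < KMV2000.qhat q := one_lt_qhat h64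
  have hqh0 : 0 < KMV2000.qhat q := zero_lt_one.trans hqh1
  have hq0 : (0 : ℝ) < q := by exact_mod_cast hq.pos
  set M : ℝ := KMV2000.qhat q ^ Δ' with hMdef
  have hL0 : 0 ≤ L := by
    have h1 : 0 ≤ Real.log (KMV2000.qhat q) := Real.log_nonneg hqh1.le
    have h2 : 0 ≤ Real.log (q : ℝ) := Real.log_nonneg (by exact_mod_cast hq.one_lt.le)
    positivity
  -- the inner constant
  set c : ℝ := 8 * π ^ 2 * C * Z₁ * ((q : ℝ)) ^ (-(3 / 2 : ℝ)) * (((R + 1 : ℕ) : ℝ)) ^ (-(12 / 25 : ℝ)) with hcdef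
  have hc0 : 0 ≤ c := by positivity
  set E : ℝ := c * (B ^ 2 * C ^ 3 * M ^ (203 / 100 : ℝ)) with hEdef
  have hE0 : 0 ≤ E := by positivity
  -- inner bound at each box point
  have hinner : ∀ n₁ ∈ afeBox q, ∀ n₂ ∈ afeBox q,
      ‖∑ m₁ ∈ Icc 1 ⌊M⌋₊, ∑ m₂ ∈ Icc 1 ⌊M⌋₊,
          (KMV2000.mollifierCoeff P M m₁ : ℂ) * (KMV2000.mollifierCoeff P M m₂ : ℂ) *
          ∑ d₁ ∈ (Nat.gcd m₁ n₁).divisors, ∑ d₂ ∈ (Nat.gcd m₂ n₂).divisors,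
            ∑ r ∈ Icc (R + 1) (q ^ 8), layerKernel q r (m₁ * n₁ / d₁ ^ 2) (m₂ * n₂ / d₂ ^ 2)‖ ≤
        E * (Real.sqrt ((Nat.gcd n₁ q : ℕ) : ℝ) * ((n₁.divisors.card : ℕ) : ℝ) * Real.sqrt ((n₁ : ℝ) * n₂)) := by
    intro n₁ hn₁ n₂ hn₂
    have h := norm_pairSum_far_le hq hB hM1 hMq hC (ne_zero_of_mem_afeBox hn₁) (ne_zero_of_mem_afeBox hn₂)
      R (q ^ 8)
    rw [hEdef, hcdef]
    exact h
  -- the weight against `√(n₁n₂)`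
  have hwt : ∀ n₁ ∈ afeBox q, ∀ n₂ ∈ afeBox q,
      ‖((((n₁ : ℝ) * n₂) ^ (-(1 / 2 : ℝ)) : ℝ) : ℂ) * KMV2000.afeW (KMV2000.qhat q) i j n₁ n₂‖ *
          Real.sqrt ((n₁ : ℝ) * n₂) ≤
        Kw * L * KMV2000.qhat q ^ (51 / 25 : ℝ) * (((n₁ : ℝ)) ^ (-(51 / 50 : ℝ)) * ((n₂ : ℝ)) ^ (-(51 / 50 : ℝ))) :=
    fun n₁ hn₁ n₂ hn₂ ↦ hKw h64 hn₁ hn₂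
  -- the two `n`-sums
  have hN₁ := sum_box_rpow_divisors_gcd_le hq hC
  have hN₂ : ∑ n ∈ afeBox q, ((n : ℝ)) ^ (-(51 / 50 : ℝ)) ≤ Z₂ :=
    hZ₂s.sum_le_tsum (afeBox q) (fun n _ ↦ Real.rpow_nonneg (Nat.cast_nonneg _) _)
  have hN₂0 : 0 ≤ ∑ n ∈ afeBox q, ((n : ℝ)) ^ (-(51 / 50 : ℝ)) :=
    Finset.sum_nonneg fun n _ ↦ Real.rpow_nonneg (Nat.cast_nonneg _) _
  have hN₁0 : 0 ≤ ∑ n ∈ afeBox q, ((n : ℝ)) ^ (-(51 / 50 : ℝ)) *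
      (((n.divisors.card : ℕ) : ℝ) * Real.sqrt ((Nat.gcd n q : ℕ) : ℝ)) :=
    Finset.sum_nonneg fun n _ ↦ by positivity
  -- assemble the box sum
  have hmain : ‖∑ n₁ ∈ afeBox q, ∑ n₂ ∈ afeBox q,
          ((((n₁ : ℝ) * n₂) ^ (-(1 / 2 : ℝ)) : ℝ) : ℂ) * KMV2000.afeW (KMV2000.qhat q) i j n₁ n₂ *
          ∑ m₁ ∈ Icc 1 ⌊M⌋₊, ∑ m₂ ∈ Icc 1 ⌊M⌋₊,
            (KMV2000.mollifierCoeff P M m₁ : ℂ) * (KMV2000.mollifierCoeff P M m₂ : ℂ) *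
            ∑ d₁ ∈ (Nat.gcd m₁ n₁).divisors, ∑ d₂ ∈ (Nat.gcd m₂ n₂).divisors,
              ∑ r ∈ Icc (R + 1) (q ^ 8), layerKernel q r (m₁ * n₁ / d₁ ^ 2) (m₂ * n₂ / d₂ ^ 2)‖ ≤
        E * (Kw * L * KMV2000.qhat q ^ (51 / 25 : ℝ)) * ((2 * C * Z₁) * Z₂) := by
    calc _ ≤ ∑ n₁ ∈ afeBox q, ∑ n₂ ∈ afeBox q,
          ‖((((n₁ : ℝ) * n₂) ^ (-(1 / 2 : ℝ)) : ℝ) : ℂ) * KMV2000.afeW (KMV2000.qhat q) i j n₁ n₂‖ *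
            (E * (Real.sqrt ((Nat.gcd n₁ q : ℕ) : ℝ) * ((n₁.divisors.card : ℕ) : ℝ) * Real.sqrt ((n₁ : ℝ) * n₂))) := by
          refine (norm_sum_le _ _).trans (Finset.sum_le_sum fun n₁ hn₁ ↦ ?_)
          refine (norm_sum_le _ _).trans (Finset.sum_le_sum fun n₂ hn₂ ↦ ?_)
          rw [norm_mul]
          exact mul_le_mul_of_nonneg_left (hinner n₁ hn₁ n₂ hn₂) (norm_nonneg _)
      _ = E * ∑ n₁ ∈ afeBox q, ∑ n₂ ∈ afeBox q,
          (‖((((n₁ : ℝ) * n₂) ^ (-(1 / 2 : ℝ)) : ℝ) : ℂ) * KMV2000.afeW (KMV2000.qhat q) i j n₁ n₂‖ *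
              Real.sqrt ((n₁ : ℝ) * n₂)) *
            (Real.sqrt ((Nat.gcd n₁ q : ℕ) : ℝ) * ((n₁.divisors.card : ℕ) : ℝ)) := by
          rw [Finset.mul_sum]
          refine Finset.sum_congr rfl fun n₁ _ ↦ ?_
          rw [Finset.mul_sum]
          refine Finset.sum_congr rfl fun n₂ _ ↦ ?_
          ring
      _ ≤ E * ∑ n₁ ∈ afeBox q, ∑ n₂ ∈ afeBox q,
          (Kw * L * KMV2000.qhat q ^ (51 / 25 : ℝ) * (((n₁ : ℝ)) ^ (-(51 / 50 : ℝ)) * ((n₂ : ℝ)) ^ (-(51 / 50 : ℝ)))) *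
            (Real.sqrt ((Nat.gcd n₁ q : ℕ) : ℝ) * ((n₁.divisors.card : ℕ) : ℝ)) := by
          refine mul_le_mul_of_nonneg_left
            (Finset.sum_le_sum fun n₁ hn₁ ↦ Finset.sum_le_sum fun n₂ hn₂ ↦ ?_) hE0
          exact mul_le_mul_of_nonneg_right (hwt n₁ hn₁ n₂ hn₂) (by positivity)
      _ = E * (Kw * L * KMV2000.qhat q ^ (51 / 25 : ℝ)) *
          ((∑ n ∈ afeBox q, ((n : ℝ)) ^ (-(51 / 50 : ℝ)) *
              (((n.divisors.card : ℕ) : ℝ) * Real.sqrt ((Nat.gcd n q : ℕ) : ℝ))) *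
            (∑ n ∈ afeBox q, ((n : ℝ)) ^ (-(51 / 50 : ℝ)))) := by
          rw [Finset.sum_mul_sum, Finset.mul_sum, Finset.mul_sum]
          refine Finset.sum_congr rfl fun n₁ _ ↦ ?_
          rw [Finset.mul_sum, Finset.mul_sum]
          refine Finset.sum_congr rfl fun n₂ _ ↦ ?_
          ring
      _ ≤ E * (Kw * L * KMV2000.qhat q ^ (51 / 25 : ℝ)) * ((2 * C * Z₁) * Z₂) := by
          refine mul_le_mul_of_nonneg_left (mul_le_mul hN₁ hN₂ hN₂0 (by positivity)) (by positivity)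
  refine hmain.trans ?_
  -- exponent bookkeeping: `q^{-3/2} (R+1)^{-12/25} M^{203/100} q̂^{51/25} ≤ q̂^{-3/40}`
  have hq32 : ((q : ℝ)) ^ (-(3 / 2 : ℝ)) ≤ KMV2000.qhat q ^ (-(3 : ℝ)) := by
    have h := level_rpow_neg_le (q := q) (s := 3 / 2) (by norm_num)
    rw [show (2 * (3 / 2 : ℝ)) = 3 by norm_num] at h
    exact h
  have hRle : (((R + 1 : ℕ) : ℝ)) ^ (-(12 / 25 : ℝ)) ≤ KMV2000.qhat q ^ ((4 * Δ' - 3 / 2) * (-(12 / 25 : ℝ))) := by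
    rw [Real.rpow_mul hqh0.le]
    exact Real.rpow_le_rpow_of_nonpos (Real.rpow_pos_of_pos hqh0 _) hR (by norm_num)
  have hM203 : M ^ (203 / 100 : ℝ) = KMV2000.qhat q ^ (Δ' * (203 / 100 : ℝ)) := by
    rw [hMdef, ← Real.rpow_mul hqh0.le]
  have hprod : ((q : ℝ)) ^ (-(3 / 2 : ℝ)) * (((R + 1 : ℕ) : ℝ)) ^ (-(12 / 25 : ℝ)) * M ^ (203 / 100 : ℝ) *
      KMV2000.qhat q ^ (51 / 25 : ℝ) ≤ KMV2000.qhat q ^ (-(3 / 40 : ℝ)) := by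
    calc ((q : ℝ)) ^ (-(3 / 2 : ℝ)) * (((R + 1 : ℕ) : ℝ)) ^ (-(12 / 25 : ℝ)) * M ^ (203 / 100 : ℝ) *
          KMV2000.qhat q ^ (51 / 25 : ℝ)
        ≤ KMV2000.qhat q ^ (-(3 : ℝ)) * KMV2000.qhat q ^ ((4 * Δ' - 3 / 2) * (-(12 / 25 : ℝ))) *
            KMV2000.qhat q ^ (Δ' * (203 / 100 : ℝ)) * KMV2000.qhat q ^ (51 / 25 : ℝ) := by
          rw [hM203]
          gcongr
      _ = KMV2000.qhat q ^ (-(3 : ℝ) + (4 * Δ' - 3 / 2) * (-(12 / 25 : ℝ)) + Δ' * (203 / 100 : ℝ) + 51 / 25) := by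
          rw [Real.rpow_add hqh0, Real.rpow_add hqh0, Real.rpow_add hqh0]
      _ ≤ KMV2000.qhat q ^ (-(3 / 40 : ℝ)) :=
          Real.rpow_le_rpow_of_exponent_le hqh1.le (by nlinarith)
  calc E * (Kw * L * KMV2000.qhat q ^ (51 / 25 : ℝ)) * ((2 * C * Z₁) * Z₂)
      = 8 * π ^ 2 * C * Z₁ * (B ^ 2 * C ^ 3) * Kw * (2 * C * Z₁) * Z₂ * L *
          (((q : ℝ)) ^ (-(3 / 2 : ℝ)) * (((R + 1 : ℕ) : ℝ)) ^ (-(12 / 25 : ℝ)) * M ^ (203 / 100 : ℝ) *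
            KMV2000.qhat q ^ (51 / 25 : ℝ)) := by
        rw [hEdef, hcdef]; ring
    _ ≤ 8 * π ^ 2 * C * Z₁ * (B ^ 2 * C ^ 3) * Kw * (2 * C * Z₁) * Z₂ * L * KMV2000.qhat q ^ (-(3 / 40 : ℝ)) :=
        mul_le_mul_of_nonneg_left hprod (by positivity)

end Summit.Parity.GeneralizedHardyLittlewood.Theorems.MomentsBeyondDiagonal.FarLayers

end
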